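import Mathlib
import Summits.ValiantsHypothesis.ValiantsHypothesis.Theorems.DivisionGapPerMultiplesHardStubTorus
import Summits.ValiantsHypothesis.ValiantsHypothesis.Theorems.DivisionGapZeroOneTransferTorusD
import Summits.ValiantsHypothesis.ValiantsHypothesis.Theorems.DivisionGapZeroOneTransferOffHoriz

/-!
# Crux `DivisionGap.ZeroOneTransfer` (stmt-ValiantsHypothesis-5066), line `charged-uncharged`, Part E (lead c13) —
stubs `stub_isolate_pred` (P1), `stub_offDiag_rigid` (P2) and `stub_torusPer` (P3) of Part E-IV
(the H1 transfer of rung E-II: cofactors of the PERMANENT with few monomials)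

The variables of `per_n = perPoly (Fin n) ℝ≥0 = ∑_π ∏_i X (π i, i)` are the cells
`(row, column) : Fin n × Fin n`.

* `stub_isolate_pred` (P1, LEXICOGRAPHIC PENALTY ISOLATION for a generic predicate `Q`): in a finite
  nonempty set `S` of exponents any two of which differ at a variable satisfying `Q`, some `û ∈ S` is
  the STRICT minimiser of a penalty weight `Finsupp.weight p` with `p` supported on a set `F` of fewer
  than `#S` variables satisfying `Q`.  The proof is that of `stub_isolate_offHoriz` (E7, predicate
  `¬ IsHoriz`) verbatim: strong induction on `S`; a singleton takes `F = ∅`, `p = 0`; otherwise two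
  distinct members differ at some `e` with `Q e`, the minimisers `S'` of `u ↦ u e` form a nonempty
  proper subset, the induction hypothesis isolates `û ∈ S'` by `(F', p')`, and `F = insert e F'`,
  `p = p' + M · [· = e]` with `M` exceeding every `weight p' u`, `u ∈ S`, isolates `û` in `S`
  (`OffHoriz.weight_add_ite`: `weight p u = weight p' u + u e * M`).
* `stub_offDiag_rigid` (P2, OFF-DIAGONAL RIGIDITY): two exponents with the same column margins which
  agree at every off-diagonal cell are equal — the diagonal entry `u (j, j)` is the column margin at `j`
  minus the off-diagonal part of column `j` (`Fintype.sum_eq_add_sum_compl`).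
* `stub_torusPer` (P3, TORUS WLOG FOR `per_n` INSIDE THE SUPPORT): the construction of
  `exists_torus_multiple_le` (`DivisionGapPerMultiplesHardStubTorus`: iterated free top components
  `ws.foldr topComponent h` along the `2n` row/column indicator weights, for each of which `per_n` is
  homogeneous of degree `1`), together with `supp h₁ ⊆ supp h`
  (`TorusD.support_foldr_topComponent_subset`) and the two margin statements bundled per pair.
[folklore]
-/

noncomputable section

set_option linter.dupNamespace false

namespace Summit.ValiantsHypothesis.ValiantsHypothesis.Theorems.DivisionGapZeroOneTransfer

open MvPolynomial
open Literature.Computability.AlgebraicComplexity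
open Summit.ValiantsHypothesis.ValiantsHypothesis.Theorems.ZeroOneTransfer
open scoped NNReal BigOperators

-- adapted from DivisionGapZeroOneTransferOffHoriz (`stub_isolate_offHoriz`)
/-- **Stub P1 — LEXICOGRAPHIC PENALTY ISOLATION, generic form.**  In a finite nonempty set of
exponents any two of which differ at a variable satisfying `Q`, one exponent is the strict minimiser of
a weight supported on fewer than `#S` variables satisfying `Q` (split off the minimisers of one
separating variable and recurse). [folklore] -/
theorem stub_isolate_pred : ∀ (σ : Type) [DecidableEq σ] (Q : σ → Prop) [DecidablePred Q]
    (S : Finset (σ →₀ ℕ)), S.Nonempty →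
    (∀ u ∈ S, ∀ u' ∈ S, (∀ e : σ, Q e → u e = u' e) → u = u') →
    ∃ (F : Finset σ) (p : σ → ℕ) (û : σ →₀ ℕ), û ∈ S ∧ F.card + 1 ≤ S.card ∧
      (∀ e ∈ F, Q e) ∧ (∀ e ∈ F, 0 < p e) ∧ (∀ e, e ∉ F → p e = 0) ∧
      (∀ u ∈ S, u ≠ û → Finsupp.weight p û < Finsupp.weight p u) := by
  intro σ _ Q _ S
  induction S using Finset.strongInduction with
  | H S ih =>
  intro hS hsep
  by_cases hc : ∀ u₁ ∈ S, ∀ u₂ ∈ S, u₁ = u₂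
  · -- `S` is a singleton: the zero weight on no variables
    obtain ⟨û, hû⟩ := hS
    refine ⟨∅, fun _ => 0, û, hû, ?_, ?_, ?_, ?_, ?_⟩
    · simpa using Finset.card_pos.2 ⟨û, hû⟩
    · simp
    · simp
    · simp
    · intro u hu hne
      exact absurd (hc u hu û hû) hne
  · push Not at hc
    obtain ⟨u₁, hu₁, u₂, hu₂, hne⟩ := hc
    -- a separating variable `e` with `Q e`
    obtain ⟨e, he, hne'⟩ : ∃ e, Q e ∧ u₁ e ≠ u₂ e := by
      by_contra h
      push Not at h
      exact hne (hsep u₁ hu₁ u₂ hu₂ h)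
    -- the minimisers `S'` of `u ↦ u e`
    set m₀ := S.inf' hS (fun u => u e) with hm₀
    set S' := S.filter (fun u => u e = m₀) with hS'
    have hsub : S' ⊆ S := Finset.filter_subset _ _
    have hss : S' ⊂ S := by
      rw [hS', Finset.filter_ssubset]
      by_cases h1 : u₁ e = m₀
      · exact ⟨u₂, hu₂, fun h2 => hne' (h1.trans h2.symm)⟩
      · exact ⟨u₁, hu₁, h1⟩
    have hS'ne : S'.Nonempty := by
      obtain ⟨u, hu, hue⟩ := Finset.exists_mem_eq_inf' hS (fun u => u e)
      exact ⟨u, Finset.mem_filter.2 ⟨hu, hue.symm⟩⟩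
    have hsep' : ∀ u ∈ S', ∀ u' ∈ S', (∀ x : σ, Q x → u x = u' x) → u = u' :=
      fun u hu u' hu' h => hsep u (hsub hu) u' (hsub hu') h
    obtain ⟨F', p', û, hû', hcard', hFQ', hpos', hzero', hmin'⟩ := ih S' hss hS'ne hsep'
    have hûS : û ∈ S := hsub hû'
    have hûe : û e = m₀ := (Finset.mem_filter.1 hû').2
    -- the new penalty: a spike at `e` dominating all the old weights
    set M := S.sup (fun u => Finsupp.weight p' u) + 1 with hM
    refine ⟨insert e F', fun x => p' x + (if x = e then M else 0), û, hûS, ?_, ?_, ?_, ?_, ?_⟩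
    · have h1 := Finset.card_insert_le e F'
      have h2 := Finset.card_lt_card hss
      omega
    · intro x hx
      rcases Finset.mem_insert.1 hx with rfl | hx
      · exact he
      · exact hFQ' x hx
    · intro x hx
      rcases Finset.mem_insert.1 hx with rfl | hx
      · simp only [if_true]
        omega
      · have := hpos' x hx
        dsimp only
        omega
    · intro x hx
      rw [Finset.mem_insert, not_or] at hx
      simp [hx.1, hzero' x hx.2]
    · intro u hu hne
      rw [OffHoriz.weight_add_ite, OffHoriz.weight_add_ite, hûe]
      by_cases hue : u e = m₀
      · have hu' : u ∈ S' := Finset.mem_filter.2 ⟨hu, hue⟩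
        have := hmin' u hu' hne
        rw [hue]
        omega
      · have h1 : m₀ ≤ u e := Finset.inf'_le _ hu
        have h2 : m₀ + 1 ≤ u e := by omega
        have h3 : Finsupp.weight p' û ≤ S.sup (fun u => Finsupp.weight p' u) :=
          Finset.le_sup (f := fun u => Finsupp.weight p' u) hûS
        have h4 : Finsupp.weight p' û + 1 ≤ M := by rw [hM]; omega
        have h5 : (m₀ + 1) * M ≤ u e * M := Nat.mul_le_mul_right M h2
        nlinarith [h4, h5]

/-- **Stub P2 — OFF-DIAGONAL RIGIDITY for the permanent's variables.**  Two exponents with the same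
column margins which agree at every off-diagonal cell `(i, j)`, `i ≠ j`, are equal: the diagonal entry
of column `j` is its margin minus its off-diagonal part. [folklore] -/
theorem stub_offDiag_rigid : ∀ (n : ℕ) (u u' : Fin n × Fin n →₀ ℕ),
    (∀ j : Fin n, ∑ i, u (i, j) = ∑ i, u' (i, j)) →
    (∀ e : Fin n × Fin n, e.1 ≠ e.2 → u e = u' e) → u = u' := by
  intro n u u' hcol hoff
  have hdiag : ∀ j : Fin n, u (j, j) = u' (j, j) := by
    intro j
    have h1 : ∑ k, u (k, j) = u (j, j) + ∑ k ∈ ({j}ᶜ : Finset (Fin n)), u (k, j) :=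
      Fintype.sum_eq_add_sum_compl j (fun k => u (k, j))
    have h2 : ∑ k, u' (k, j) = u' (j, j) + ∑ k ∈ ({j}ᶜ : Finset (Fin n)), u' (k, j) :=
      Fintype.sum_eq_add_sum_compl j (fun k => u' (k, j))
    have hrest : ∑ k ∈ ({j}ᶜ : Finset (Fin n)), u (k, j) = ∑ k ∈ ({j}ᶜ : Finset (Fin n)), u' (k, j) :=
      Finset.sum_congr rfl fun k hk => hoff (k, j) (by simpa using hk)
    have h := hcol j
    omega
  ext ⟨i, j⟩
  by_cases hij : i = j
  · rw [hij]
    exact hdiag j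
  · exact hoff (i, j) hij

-- adapted from DivisionGapPerMultiplesHardStubTorus (`exists_torus_multiple_le`) and
-- DivisionGapZeroOneTransferTorusD (`stub_torusD`)
/-- **Stub P3 — TORUS WLOG FOR `per_n` INSIDE THE SUPPORT.**  A nonzero cofactor `h` of the permanent
may be replaced, at no cost for `L⁺(per_n · —)` and inside its own support, by a nonzero `h₁` all of
whose exponents have the same row margins and the same column margins: iterate free top components
over the `2n` row/column indicator weights, for each of which `per_n` is homogeneous of degree `1`.
[folklore] -/
theorem stub_torusPer : ∀ (n : ℕ) (h : MvPolynomial (Fin n × Fin n) ℝ≥0), h ≠ 0 →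
    ∃ h₁ : MvPolynomial (Fin n × Fin n) ℝ≥0, h₁ ≠ 0 ∧ h₁.support ⊆ h.support ∧
      (∀ d₁ ∈ h₁.support, ∀ d₂ ∈ h₁.support,
        (∀ i : Fin n, ∑ j, d₁ (i, j) = ∑ j, d₂ (i, j)) ∧ (∀ j : Fin n, ∑ i, d₁ (i, j) = ∑ i, d₂ (i, j))) ∧
      complexity (perPoly (Fin n) ℝ≥0 * h₁) ≤ complexity (perPoly (Fin n) ℝ≥0 * h) := by
  intro n h hh
  let ws : List (Fin n × Fin n → ℕ) :=
    (List.finRange n).map (fun i v => if v.1 = i then 1 else 0) ++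
      (List.finRange n).map (fun j v => if v.2 = j then 1 else 0)
  have hrow_mem : ∀ i : Fin n, (fun v : Fin n × Fin n => if v.1 = i then 1 else 0) ∈ ws :=
    fun i => List.mem_append_left _ (List.mem_map.2 ⟨i, List.mem_finRange i, rfl⟩)
  have hcol_mem : ∀ j : Fin n, (fun v : Fin n × Fin n => if v.2 = j then 1 else 0) ∈ ws :=
    fun j => List.mem_append_right _ (List.mem_map.2 ⟨j, List.mem_finRange j, rfl⟩)
  refine ⟨ws.foldr Negative.topComponent h,
    DivisionGap.PerMultiplesHard.Torus.foldr_topComponent_ne_zero ws hh,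
    TorusD.support_foldr_topComponent_subset ws h,
    fun d₁ hd₁ d₂ hd₂ => ⟨fun i => ?_, fun j => ?_⟩, ?_⟩
  · obtain ⟨m, hm⟩ :=
      DivisionGap.PerMultiplesHard.Torus.isWeightedHomogeneous_foldr_topComponent ws h (hrow_mem i)
    rw [← DivisionGap.PerMultiplesHard.Torus.weight_rowIndicator i d₁,
      ← DivisionGap.PerMultiplesHard.Torus.weight_rowIndicator i d₂,
      hm (mem_support_iff.1 hd₁), hm (mem_support_iff.1 hd₂)]
  · obtain ⟨m, hm⟩ :=
      DivisionGap.PerMultiplesHard.Torus.isWeightedHomogeneous_foldr_topComponent ws h (hcol_mem j)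
    rw [← DivisionGap.PerMultiplesHard.Torus.weight_colIndicator j d₁,
      ← DivisionGap.PerMultiplesHard.Torus.weight_colIndicator j d₂,
      hm (mem_support_iff.1 hd₁), hm (mem_support_iff.1 hd₂)]
  · refine DivisionGap.PerMultiplesHard.Torus.complexity_mul_foldr_topComponent_le ws _ h
      fun w hw => ?_
    rcases List.mem_append.1 hw with hw' | hw'
    · obtain ⟨i, -, rfl⟩ := List.mem_map.1 hw'
      exact ⟨1, DivisionGap.PerMultiplesHard.Torus.isWeightedHomogeneous_perPoly_row i⟩
    · obtain ⟨j, -, rfl⟩ := List.mem_map.1 hw'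
      exact ⟨1, DivisionGap.PerMultiplesHard.Torus.isWeightedHomogeneous_perPoly_col j⟩

end Summit.ValiantsHypothesis.ValiantsHypothesis.Theorems.DivisionGapZeroOneTransfer

end
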